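import Summits.Ventures.PercRepro.MSTightBadExtensionMain
import Summits.Ventures.PercRepro.MSTightCoverTwinFree
import Summits.Ventures.PercRepro.MSTightUpDown

/-!
# The open shape of Conjecture (T) from Theorem (E) and Theorem (i) TightExt

Dossier proofs/MINE1-theoremS.md, Addendum 54. `TightExt α` is Theorem (i) of Addendum 52
supplement 1 as a candidate Prop (never asserted here; the kernel holds it modulo two coordinate
facts, `extension_side_of_cover` in MSTightExtSide): for a tight twin-free `P` without minimum or
maximum member, a covering excess-one `K ⊆ P` and a member `m ∈ P ∖ K` eligible on both sides,
one of the two eligible sides is `{m}`.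

**Theorem** (`localDichotomyGenuine_of_tightExt`): `TightExt α → LocalDichotomyGenuine α`. Proof:
let `t ∈ P₁` lie below no member of `K`, and let `c` be the core of `K`. By Theorem S every
element has an addable or a removable twin class, and the classes are singletons. If every element
of `c` is addable, `m := t ∪ c ∈ P`, and `m` is a tight one-point extension of `K` by Theorem (E)
(`sdiff_mem_diffs_of_bad`), so `TightExt` makes `P₁` or `P₀` a singleton. If some `a ∈ c` is
removable, then every `s ∈ P₀` contains `a`, `s.erase a ∈ P₁` by the partition, and
`s \ k = s.erase a \ k`: every member of `P₀` is itself an extension, and again `TightExt` makes a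
side a singleton. Both contradict `|P₀|, |P₁| ≥ 2`.
-/

namespace PercRepro.MSTight

open Finset
open scoped FinsetFamily

variable (α : Type*) [DecidableEq α] [Fintype α]

/-- **Theorem (i) TightExt as a Prop** (Addendum 52 suppl. 1; paper). -/
def TightExt : Prop :=
  ∀ (P K : Finset (Finset α)) (m : Finset α), Tight P → (∀ a b, Twin P a b → a = b) →
    (∀ t ∈ P, ∃ p ∈ P, ¬ t ⊆ p) → (∀ t ∈ P, ∃ p ∈ P, ¬ p ⊆ t) →
    K ⊆ P → (K \\ K).card = K.card + 1 →
    (∀ p ∈ P, p ∉ K → (∀ k ∈ K, p \ k ∈ K \\ K) ∨ (∀ k ∈ K, k \ p ∈ K \\ K)) →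
    m ∈ P → m ∉ K → (∀ k ∈ K, m \ k ∈ K \\ K) → (∀ k ∈ K, k \ m ∈ K \\ K) →
    (∀ p ∈ P, p ∉ K → (∀ k ∈ K, p \ k ∈ K \\ K) → p = m) ∨
      (∀ p ∈ P, p ∉ K → (∀ k ∈ K, k \ p ∈ K \\ K) → p = m)

variable {α}

/-- Adding a set of addable singleton classes to a member keeps it a member. -/
theorem union_mem_of_forall_closedAdd {P : Finset (Finset α)} {t : Finset α} (ht : t ∈ P)
    (c : Finset α) (hc : ∀ a ∈ c, ClosedAdd P {a}) : t ∪ c ∈ P := by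
  induction c using Finset.induction_on with
  | empty => simpa using ht
  | insert a s has ih =>
    have h1 : t ∪ s ∈ P := ih fun b hb => hc b (mem_insert_of_mem hb)
    have h2 : t ∪ s ∪ {a} ∈ P := hc a (mem_insert_self a s) _ h1
    have e : t ∪ insert a s = t ∪ s ∪ {a} := by
      ext x
      simp only [mem_union, mem_insert, mem_singleton]
      tauto
    rw [e]
    exact h2

omit [Fintype α] in
/-- A core element of `K` lies in every `P₀`-eligible set. -/
theorem mem_of_forall_sdiff_mem {K : Finset (Finset α)} {s : Finset α} {a : α}
    (ha : ∀ k ∈ K, a ∈ k) (hne : K.Nonempty) (hs : ∀ k ∈ K, k \ s ∈ K \\ K) : a ∈ s := by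
  obtain ⟨k, hk⟩ := hne
  by_contra has
  obtain ⟨k₁, hk₁, k₂, hk₂, h⟩ := mem_diffs.1 (hs k hk)
  have : a ∈ k \ s := mem_sdiff.2 ⟨ha k hk, has⟩
  rw [← h] at this
  exact (mem_sdiff.1 this).2 (ha k₂ hk₂)

/-- **Theorem (Addendum 54).** Theorem (i) TightExt implies the local dichotomy in its genuine
form — the open shape of Conjecture (T). -/
theorem localDichotomyGenuine_of_tightExt (hTE : TightExt α) : LocalDichotomyGenuine α := by
  intro P K P₀ P₁ hP htf hmin hmax hKP hU hD hK h1 h0 hc0 hc1 t ht₁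
  by_contra hnot
  push Not at hnot
  have hne : K.Nonempty := by
    rw [nonempty_iff_ne_empty]
    rintro rfl
    simp at hK
  -- `t ∈ P ∖ K`
  have htPK : t ∈ P \ K := by
    rw [← hU]
    exact mem_union_right _ ht₁
  have htP : t ∈ P := (mem_sdiff.1 htPK).1
  have htK : t ∉ K := (mem_sdiff.1 htPK).2
  have hcov := cover_of_partition hU h1 h0
  have ht : ∀ k ∈ K, t \ k ∈ K \\ K := fun k hk => h1 (mem_diffs.2 ⟨t, ht₁, k, hk, rfl⟩)
  -- `K` is twin-free on its support
  have hKtf : ∀ a b, (∃ k ∈ K, a ∈ k) → (∃ k ∈ K, a ∉ k) → (∃ k ∈ K, b ∈ k) →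
      (∃ k ∈ K, b ∉ k) → Twin K a b → a = b :=
    fun a b ha ha' _ _ hab => eq_of_twin_of_partition htf hU h1 h0 hab ha ha'
  -- a side with two members is not `{m}`
  have two0 : ∀ m, ¬ ∀ p ∈ P, p ∉ K → (∀ k ∈ K, k \ p ∈ K \\ K) → p = m := by
    intro m h
    obtain ⟨s₁, hs₁, s₂, hs₂, hne12⟩ := one_lt_card.1 hc0
    have hs₁' : s₁ ∈ P \ K := by rw [← hU]; exact mem_union_left _ hs₁
    have hs₂' : s₂ ∈ P \ K := by rw [← hU]; exact mem_union_left _ hs₂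
    have e1 := h s₁ (mem_sdiff.1 hs₁').1 (mem_sdiff.1 hs₁').2
      (fun k hk => h0 (mem_diffs.2 ⟨k, hk, s₁, hs₁, rfl⟩))
    have e2 := h s₂ (mem_sdiff.1 hs₂').1 (mem_sdiff.1 hs₂').2
      (fun k hk => h0 (mem_diffs.2 ⟨k, hk, s₂, hs₂, rfl⟩))
    exact hne12 (e1.trans e2.symm)
  have two1 : ∀ m, ¬ ∀ p ∈ P, p ∉ K → (∀ k ∈ K, p \ k ∈ K \\ K) → p = m := by
    intro m h
    obtain ⟨s₁, hs₁, s₂, hs₂, hne12⟩ := one_lt_card.1 hc1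
    have hs₁' : s₁ ∈ P \ K := by rw [← hU]; exact mem_union_right _ hs₁
    have hs₂' : s₂ ∈ P \ K := by rw [← hU]; exact mem_union_right _ hs₂
    have e1 := h s₁ (mem_sdiff.1 hs₁').1 (mem_sdiff.1 hs₁').2
      (fun k hk => h1 (mem_diffs.2 ⟨s₁, hs₁, k, hk, rfl⟩))
    have e2 := h s₂ (mem_sdiff.1 hs₂').1 (mem_sdiff.1 hs₂').2
      (fun k hk => h1 (mem_diffs.2 ⟨s₂, hs₂, k, hk, rfl⟩))
    exact hne12 (e1.trans e2.symm)
  -- the core of `K` and the class dichotomy of `P`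
  set c : Finset α := Finset.univ.filter fun a => ∀ k ∈ K, a ∈ k with hc
  have hcmem : ∀ a, a ∈ c ↔ ∀ k ∈ K, a ∈ k := by
    intro a
    simp [hc]
  have hdich := dichotomy_of_tight hP
  by_cases hrem : ∃ a ∈ c, ClosedRem P {a}
  · -- Case 2: a removable core element makes every member of `P₀` an extension
    obtain ⟨a, hac, hrem⟩ := hrem
    have ha : ∀ k ∈ K, a ∈ k := (hcmem a).1 hac
    obtain ⟨s, hs⟩ : P₀.Nonempty := card_pos.1 (by omega)
    have hsPK : s ∈ P \ K := by rw [← hU]; exact mem_union_left _ hs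
    have hs0 : ∀ k ∈ K, k \ s ∈ K \\ K := fun k hk => h0 (mem_diffs.2 ⟨k, hk, s, hs, rfl⟩)
    have has : a ∈ s := mem_of_forall_sdiff_mem ha hne hs0
    have hs'P : s \ {a} ∈ P := hrem s (mem_sdiff.1 hsPK).1
    have hs'K : s \ {a} ∉ K := fun h => (mem_sdiff.1 (ha _ h)).2 (mem_singleton_self a)
    have hs'1 : s \ {a} ∈ P₁ := by
      have h' : s \ {a} ∈ P₀ ∪ P₁ := by
        rw [hU]
        exact mem_sdiff.2 ⟨hs'P, hs'K⟩
      rcases mem_union.1 h' with h'' | h''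
      · exfalso
        have := mem_of_forall_sdiff_mem ha hne
          (fun k hk => h0 (mem_diffs.2 ⟨k, hk, s \ {a}, h'', rfl⟩))
        exact (mem_sdiff.1 this).2 (mem_singleton_self a)
      · exact h''
    have hs1 : ∀ k ∈ K, s \ k ∈ K \\ K := by
      intro k hk
      have e : s \ k = (s \ {a}) \ k := by
        ext x
        simp only [mem_sdiff, mem_singleton]
        constructor
        · rintro ⟨hxs, hxk⟩
          exact ⟨⟨hxs, fun hxa => hxk (hxa ▸ ha k hk)⟩, hxk⟩
        · rintro ⟨⟨hxs, _⟩, hxk⟩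
          exact ⟨hxs, hxk⟩
      rw [e]
      exact h1 (mem_diffs.2 ⟨s \ {a}, hs'1, k, hk, rfl⟩)
    rcases hTE P K s hP htf hmin hmax hKP hK hcov (mem_sdiff.1 hsPK).1 (mem_sdiff.1 hsPK).2
        hs1 hs0 with h | h
    · exact two1 s h
    · exact two0 s h
  · -- Case 1: every core element is addable, so `t ∪ c ∈ P` is an extension by Theorem (E)
    push Not at hrem
    have hadd : ∀ a ∈ c, ClosedAdd P {a} := by
      intro a hac
      rcases hdich a with h | h
      · rwa [cls_eq_singleton_of_twinFree htf] at h
      · rw [cls_eq_singleton_of_twinFree htf] at h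
        exact absurd h (hrem a hac)
    set m := t ∪ c with hm
    have hmP : m ∈ P := union_mem_of_forall_closedAdd htP c hadd
    have hck : ∀ k ∈ K, c ⊆ k := fun k hk x hx => (hcmem x).1 hx k hk
    have hmK : m ∉ K := fun h => hnot m h subset_union_left
    have hm1 : ∀ k ∈ K, m \ k ∈ K \\ K := by
      intro k hk
      have e : m \ k = t \ k := by
        ext x
        simp only [hm, mem_sdiff, mem_union]
        constructor
        · rintro ⟨hx | hx, hxk⟩
          · exact ⟨hx, hxk⟩
          · exact absurd (hck k hk hx) hxk
        · rintro ⟨hx, hxk⟩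
          exact ⟨Or.inl hx, hxk⟩
      rw [e]
      exact ht k hk
    have hm0 : ∀ k ∈ K, k \ m ∈ K \\ K :=
      sdiff_mem_diffs_of_bad hK hKtf (fun a ha => mem_union_right _ ((hcmem a).2 ha)) hmK hm1
        (fun k hk h => hnot k hk (subset_union_left.trans h))
    rcases hTE P K m hP htf hmin hmax hKP hK hcov hmP hmK hm1 hm0 with h | h
    · exact two1 m h
    · exact two0 m h

end PercRepro.MSTight
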